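import Summits.BirchSwinnertonDyer.Rank1Residual.Additive.CycLowerInputsBridge
import Summits.BirchSwinnertonDyer.Rank1Residual.Additive.XMultRankZeroCyclotomicPrimePrep
import Summits.BirchSwinnertonDyer.Rank1Residual.AdditivePotMult.RankZeroChiBranchPrimeFacts
import HarnessLib

/-!
# The potentially MULTIPLICATIVE locus (M), analytic rank `0`, `p ≡ 1 (mod 4)`: the LOWER half from a
# RATIONAL `χ_p`-branch main conjecture for the multiplicative twist plus ONE finite `μ`-certificate
# (cell `b2b-bsdres`, team n1011, seat n1011-p06, OWNERS row T-N10R, phase 3b)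

HONEST FRAMING (cell `b2b-bsdres`, run/shared/lean/b2b/bsd-rank1-residual/, verbatim in every
file): the goal of the cell is to DELETE the COMBINATION-SHAPED residual classes of the
Birch–Swinnerton-Dyer formula for ALL analytic-rank `≤ 1` elliptic curves over `ℚ` — "full BSD
formula for every rank `≤ 1` curve in class `C`" assembled STRICTLY from published theorems — so
that the rank-`≤ 1` remainder becomes exactly the CONSTRUCTION-SHAPED classes, which are TYPED
(missing-input `Prop`s), NOT attempted. This is not "finishing BSD". Team n1011 (X4 ∧ `p = 3` / the
additive block, §I items N10 / N11): research routes; prove what is provable now; no claim beyond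
the stated classes; X4(M) / X4♯(G-ord) stay CONSTRUCTION-SHAPED; labels / census / located gap
UNCHANGED; nothing is booked. One definition + one `abbrev` (typed input / certificate shape, nothing asserted) and
theorems; no new named fact.

## What and why

Phases 1–2 (`GordRatMainConjLowerBound[Odd].lean`) transplanted the X9 gen-9 mechanism — a RATIONAL
cyclotomic main conjecture ("`char = (p^k · 𝓛)`", the native shape of Skinner–Urban-type theorems,
BCS 2025 Thm. 1.1.2 (a)) plus ONE unit coefficient of the Néron-normalised `p`-adic `L`-series forces
`k ≥ 0` — to the (G-ord, `e = 2`) rows. This file does the same on the potentially MULTIPLICATIVE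
locus (M) = `Addv ∧ ord_p j < 0` (X4(M), the largest block of the additive residue) at `p ≡ 1 (mod 4)`:
there `E = E♭ ⊗ χ_p` with `E♭` MULTIPLICATIVE at `p` (`AdditivePotMult.ClassX4M.exists_mult_pStar_twist_model`),
and the relevant `p`-adic `L`-series is the even `ω^{(p−1)/2}`-branch of the ONE-TERM Mazur–Tate–Teitelbaum
measure of `f♭` (`a_p(f♭) = ±1`), `padicLFunctionPlusBranchMult f♭ a_p (p/2)`, with constant term
`a_p⁻¹ ∑_{a mod p} (a/p)[a/p]⁺_{f♭}` (tree theorem `constantCoeff_padicLFunctionPlusBranchMult_half`).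

* §1 TYPED: `ChiBranchRatCharEqMultAt W p` — the branch main conjecture of the multiplicative twist as a
  RATIONAL equality (`char_Λ X(E/ℚ_∞) = (g)`, `ι g = p^k · ϖ · L_p⁺(f♭, a_p, ω^{(p−1)/2}, T)`, `k ∈ ℤ`).
  Nothing asserted. `MultBranchUnitCoeffCert W p` — the certificate shape (one unit coefficient).
* §2 KERNEL: `cycLowerLeadingTermAt_of_chiBranchRatCharEqMult_of_unitCoeff` — (§1) + certificate ⟹
  `k ≥ 0` (`X9.exponent_nonneg_of_exists_norm_coeff_eq_one`) ⟹ additive-p2's `CycLowerLeadingTermAt W p`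
  (≡ p18's `CycLeadingTermDvdAt W p`, `CycLowerInputsBridge.lean`), by MTT §I.14 and Birch + Pal
  (`entireLFunction_one_eq_of_twist`).
* §3 CONSEQUENCES on X4(M), `r_an = 0`: `MissingLowerBoundAt W p` through n1011-p18's
  `ClassX4M.missingLowerBoundAt_rankZero_of_cycLeadingTermDvd` (Delbourgo 1998 Prop. 4 + §2.2 Lemma (ii),
  EXACT on (M), `hDelX`) — NO anomalous / non-CM / `p ≥ 5` restriction — and `BSD(E,p)` on X4(M) ∧ surj(p)
  with additive-p1's printed upper half (`ClassX4M.bsdp_rankZero_of_surj_of_lower`).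

Located gap (unchanged in substance, sharpened in form): the Eisenstein divisibility of the
`ω^{(p−1)/2}`-branch main conjecture for a MULTIPLICATIVE newform, rationally, is in no printed source
(Skinner 2016 / BCS 2025: trivial branch); the Kato half is Kato 2004 Thm. 17.4 / EPW 2006 Thm. 5.1.2.
X4(M) stays CONSTRUCTION-SHAPED; nothing booked.

References: Burungale–Castella–Skinner, IMRN 2025 Thm. 1.1.2 (a) [BurungaleCastellaSkinner2025];
Mazur–Tate–Teitelbaum, Invent. Math. 84 (1986) §I.10, §I.13–I.14 [MazurTateTeitelbaum1986Invent];
Pal, Proc. AMS (2012) Thm. 3.2 [Pal2012]; Delbourgo, Compositio Math. 113 (1998) Prop. 4, §2.2 Lemma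
(ii) [Delbourgo1998]; Kato, Astérisque 295 (2004) Thm. 17.4 [Kato2004Asterisque]; Wuthrich, Doc. Math.
19 (2014) Lemma 20 [Wuthrich2014]; Miller, LMS J. Comput. Math. 14 (2011) Def. 1.1 [Miller2011LMS].
-/

noncomputable section

open scoped Classical MatrixGroups ModularForm NumberField

open CongruenceSubgroup WeierstrassCurve NumberField Literature.NumberTheory.EllipticCurves
  Literature.NumberTheory.EllipticCurves.ModularForms
  Literature.NumberTheory.EllipticCurves.Rank1Residual
  Literature.NumberTheory.EllipticCurves.Rank1Residual.Typed
  IsDedekindDomain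

namespace Summit.BirchSwinnertonDyer.Rank1Residual.Additive

variable (W : WeierstrassCurve ℚ) [W.IsElliptic] [W.IsGloballyMinimal] (p : ℕ) [hp : Fact p.Prime]

/-! ### §1 The typed input and the certificate shape -/

/-- **The `ω^{(p−1)/2}`-branch cyclotomic main conjecture for the MULTIPLICATIVE twist, RATIONAL
form, TYPED** (`p ≡ 1 (mod 4)`, even branch of the one-term measure). For the additive curve `E = W`
(globally minimal): whenever `W` is `ℚ`-isomorphic to the quadratic twist by `p` of a globally minimal
`V = E♭` MULTIPLICATIVE at `p`, `f` is the newform of `V` with `a_p(f) = ap` (`= ±1`), `κ`/`γ` the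
cyclotomic `ℤ_p`-extension with a topological generator matching the cyclotomic variable, `D` a
Pontryagin-dual datum of `Sel_{p^∞}(W/ℚ_∞)` and `ϖ · Ω_V = Ω⁺_f`, then `X(W/ℚ_∞)` is `Λ`-torsion and
`char_Λ X(W/ℚ_∞) = (g)` with `ι g = p^k · ϖ · L_p⁺(f, ap, ω^{(p−1)/2}, T)` for some `k ∈ ℤ`
(`padicLFunctionPlusBranchMult`, MTT §I.10 (10.1) with `ε(p) = 0`, §I.13): BCS 2025 Thm. 1.1.2 (a)
SHAPE. OPEN — a predicate on `(W, p)`; nothing asserted (Kato half: Kato 2004 Thm. 17.4; Eisenstein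
half on a non-trivial branch of a multiplicative form: no printed source).
[cite: BurungaleCastellaSkinner2025, Thm. 1.1.2 (a) (shape only; nothing asserted)]
[cite: MazurTateTeitelbaum1986Invent, §I.13 (shape only; nothing asserted)] -/
def ChiBranchRatCharEqMultAt (W : WeierstrassCurve ℚ) (p : ℕ) [Fact p.Prime] : Prop :=
  ∀ (V : WeierstrassCurve ℚ) [V.IsElliptic] [V.IsGloballyMinimal]
    {κ : ZpExtension ℚ p} {γ : Field.absoluteGaloisGroup ℚ} {N : ℕ} [NeZero N]
    {f : CuspForm (Gamma0 N) 2},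
    p % 4 = 1 →
    (∃ C : VariableChange ℚ, C • V.quadraticTwist (p : ℚ) = W) →
    Mult V p →
    κ.IsCyclotomic → κ.IsTopGenerator γ → IsCyclotomicVariable p γ → IsNewformOf V f →
    ∀ (ap : ℤ), cuspCoeff f p = ap →
    ∀ (D : W.SelmerDualData κ γ) (ϖ : ℚ), (ϖ : ℝ) * V.realPeriodRat = plusPeriod f →
      D.IsTorsion ∧
      ∃ (g : IwasawaAlgebra p) (k : ℤ), D.charIdeal = Ideal.span {g} ∧
        iwasawaToPowerSeries p g =
          PowerSeries.C ((p : ℚ_[p]) ^ k * (ϖ : ℚ_[p])) *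
            padicLFunctionPlusBranchMult f (ap : ℚ_[p]) (p / 2)

/-- Unfolding lemma for `ChiBranchRatCharEqMultAt`. -/
theorem chiBranchRatCharEqMultAt_iff (W : WeierstrassCurve ℚ) (p : ℕ) [Fact p.Prime] :
    ChiBranchRatCharEqMultAt W p ↔
      ∀ (V : WeierstrassCurve ℚ) [V.IsElliptic] [V.IsGloballyMinimal]
        {κ : ZpExtension ℚ p} {γ : Field.absoluteGaloisGroup ℚ} {N : ℕ} [NeZero N]
        {f : CuspForm (Gamma0 N) 2},
        p % 4 = 1 →
        (∃ C : VariableChange ℚ, C • V.quadraticTwist (p : ℚ) = W) →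
        Mult V p →
        κ.IsCyclotomic → κ.IsTopGenerator γ → IsCyclotomicVariable p γ → IsNewformOf V f →
        ∀ (ap : ℤ), cuspCoeff f p = ap →
        ∀ (D : W.SelmerDualData κ γ) (ϖ : ℚ), (ϖ : ℝ) * V.realPeriodRat = plusPeriod f →
          D.IsTorsion ∧
          ∃ (g : IwasawaAlgebra p) (k : ℤ), D.charIdeal = Ideal.span {g} ∧
            iwasawaToPowerSeries p g =
              PowerSeries.C ((p : ℚ_[p]) ^ k * (ϖ : ℚ_[p])) *
                padicLFunctionPlusBranchMult f (ap : ℚ_[p]) (p / 2) :=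
  Iff.rfl

/-- The certificate hypothesis of the (M) class forms, `p ≡ 1 (mod 4)`: for every multiplicative twist
model `V` (`C • V^{(p)} = W`), its newform `f` with `a_p(f) = ap`, and `ϖ·Ω_V = Ω⁺_f`, SOME coefficient of
`ϖ · L_p⁺(f, ap, ω^{(p−1)/2}, T)` is a `p`-adic unit (one modular-symbol computation on `E♭`). -/
abbrev MultBranchUnitCoeffCert (W : WeierstrassCurve ℚ) (p : ℕ) [Fact p.Prime] : Prop :=
  ∀ (V : WeierstrassCurve ℚ) [V.IsElliptic] [V.IsGloballyMinimal] (C : VariableChange ℚ),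
    Mult V p → C • V.quadraticTwist (p : ℚ) = W →
    ∀ {N : ℕ} [NeZero N] (f : CuspForm (Gamma0 N) 2), IsNewformOf V f → ∀ (ap : ℤ), cuspCoeff f p = ap →
    ∀ ϖ : ℚ, (ϖ : ℝ) * V.realPeriodRat = plusPeriod f →
    ∃ n : ℕ, ‖PowerSeries.coeff n
      (PowerSeries.C (ϖ : ℚ_[p]) * padicLFunctionPlusBranchMult f (ap : ℚ_[p]) (p / 2))‖ = 1

/-! ### §2 The kernel step on (M), even branch -/

/-- **(M), `p ≡ 1 (mod 4)`: rational branch main conjecture of the multiplicative twist + ONE unit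
coefficient ⟹ the LOWER divisibility at `T = 0`.** `E = W` globally minimal, additive at `p`,
`ℚ`-isomorphic to `V^{(p)}` with `V` MULTIPLICATIVE at `p`, newform `f`, `a_p(f) = ap ∈ {±1}`, `p ∣ N`,
`ϖ·Ω_V = Ω⁺_f`; `ChiBranchRatCharEqMultAt W p` and a unit coefficient of `ϖ · L_p⁺(f, ap, ω^{(p−1)/2}, T)`
⟹ `CycLowerLeadingTermAt W p`. Ingredients: `X9.exponent_nonneg_of_exists_norm_coeff_eq_one` (`k ≥ 0`),
`constantCoeff_padicLFunctionPlusBranchMult_half` (MTT §I.14: `ap⁻¹ ∑ (a/p)[a/p]⁺_f`), Birch + Pal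
(`entireLFunction_one_eq_of_twist`, `hPal`, `hmod`). [cite: MazurTateTeitelbaum1986Invent, §I.14] [cite: Pal2012, Thm. 3.2] -/
theorem cycLowerLeadingTermAt_of_chiBranchRatCharEqMult_of_unitCoeff
    (hPal : Pal2012.thm32_sqrt_mul_realPeriodRat_twist_eq_of_prime_one_mod_four)
    (hmod : hasEntireLFunction_rat) (hp4 : p % 4 = 1) (hadd : Addv W p)
    (V : WeierstrassCurve ℚ) [V.IsElliptic] [V.IsGloballyMinimal]
    (hVW : ∃ C : VariableChange ℚ, C • V.quadraticTwist (p : ℚ) = W) (hV : Mult V p)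
    {N : ℕ} [NeZero N] {f : CuspForm (Gamma0 N) 2} (hf : IsNewformOf V f) (hpN : p ∣ N)
    {ap : ℤ} (hap : cuspCoeff f p = ap) (hap1 : ap = 1 ∨ ap = -1)
    (ϖ : ℚ) (hϖ : (ϖ : ℝ) * V.realPeriodRat = plusPeriod f)
    (hMC : ChiBranchRatCharEqMultAt W p)
    (hcert : ∃ n : ℕ, ‖PowerSeries.coeff n
        (PowerSeries.C (ϖ : ℚ_[p]) * padicLFunctionPlusBranchMult f (ap : ℚ_[p]) (p / 2))‖ = 1) :
    CycLowerLeadingTermAt W p := by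
  have hpP : p.Prime := hp.out
  have hp2 : p ≠ 2 := by omega
  have hap0 : (ap : ℚ_[p]) ≠ 0 := by rcases hap1 with rfl | rfl <;> norm_num
  have hapinv : (ap : ℚ_[p])⁻¹ = (ap : ℚ_[p]) := by rcases hap1 with rfl | rfl <;> norm_num
  intro κ γ hκ hγ hγ' D f' hf'
  obtain ⟨-, g, k, hchar, hιg⟩ := hMC V hp4 hVW hV hκ hγ hγ' hf ap hap D ϖ hϖ
  have hιg' : iwasawaToPowerSeries p g = PowerSeries.C ((p : ℚ_[p]) ^ k) *
      (PowerSeries.C (ϖ : ℚ_[p]) * padicLFunctionPlusBranchMult f (ap : ℚ_[p]) (p / 2)) := by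
    rw [hιg, map_mul, mul_assoc]
  have hk : 0 ≤ k := X9.exponent_nonneg_of_exists_norm_coeff_eq_one g _ k hιg' hcert
  obtain ⟨m, rfl⟩ : ∃ m : ℕ, k = m := ⟨k.toNat, (Int.toNat_of_nonneg hk).symm⟩
  have h0 := congrArg PowerSeries.constantCoeff hιg
  rw [constantCoeff_iwasawaToPowerSeries, map_mul, PowerSeries.constantCoeff_C,
    constantCoeff_padicLFunctionPlusBranchMult_half p hp2 hf.1 hf.coeffField_eq_bot hpN hap hap0,
    zpow_natCast, hapinv, mul_assoc] at h0
  obtain ⟨ε, hε, hLq⟩ :=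
    entireLFunction_one_eq_of_twist p hPal hmod hp4 V W hVW (Or.inr hV) hadd hf ϖ hϖ
  have hε0 : ε ≠ 0 := by rcases hε with rfl | rfl <;> norm_num
  have hεv : padicValRat p ε = 0 := by
    rcases hε with rfl | rfl
    · exact padicValRat.one
    · rw [padicValRat.neg]; exact padicValRat.one
  obtain ⟨w, hw⟩ := exists_units_coe_eq_ratCast p hε0 hεv
  have hε2 : ((ε : ℚ) : ℚ_[p]) ^ 2 = 1 := by rcases hε with rfl | rfl <;> norm_num
  refine ⟨ε * (ϖ * legendrePlusSymbolSum f p), hLq,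
    exists_padicInt_constantCoeff_generator_of_pow_mul D hchar hf' h0 ((ap : ℤ_[p]) * (w : ℤ_[p])) ?_⟩
  push_cast
  rw [hw]
  linear_combination (-(ϖ : ℚ_[p]) * (ap : ℚ_[p]) * (legendrePlusSymbolSum f p : ℚ_[p])) * hε2

/-! ### §3 Consequences on X4(M), `r_an = 0`, `p ≡ 1 (mod 4)` -/

variable {W p}

/-- **X4(M), `p ≡ 1 (mod 4)`: the integral lower divisibility at `T = 0` from the rational branch main
conjecture of the multiplicative twist and the certificate.** The twist model, its newform and
`ϖ` are produced in the kernel (`AdditivePotMult.ClassX4M.exists_mult_pStar_twist_model`,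
`nonempty_modularParametrizationData`); `a_p(E♭) = ±1` and `p ∣ N` by the split / non-split case
(`IsNewformOf.cuspCoeff_eq_one_and_sq_of_split`, `.dvd_level_of_split`,
`.cuspCoeff_eq_neg_one_and_dvd_of_nonsplit`). [cite: MazurTateTeitelbaum1986Invent, §I.14] [cite: Pal2012, Thm. 3.2] -/
theorem _root_.Summit.BirchSwinnertonDyer.Rank1Residual.AdditivePotMult.ClassX4M.cycLowerLeadingTermAt_of_ratCharEqMult_of_unitCoeff
    (hPal : Pal2012.thm32_sqrt_mul_realPeriodRat_twist_eq_of_prime_one_mod_four)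
    (hmod : hasEntireLFunction_rat) (hmodD : nonempty_modularParametrizationData)
    (hX : AdditivePotMult.ClassX4M W p) (hp4 : p % 4 = 1) (hMC : ChiBranchRatCharEqMultAt W p)
    (hcert : MultBranchUnitCoeffCert W p) : CycLowerLeadingTermAt W p := by
  obtain ⟨V, iV, iVm, C, hV, hC⟩ := hX.exists_mult_pStar_twist_model
  haveI : NeZero (V.conductorNorm ℤ) := ⟨(V.conductorNorm_pos_holds).ne'⟩
  obtain ⟨Dm⟩ := hmodD V
  obtain ⟨ϖ, -, hϖ, -⟩ := Dm.exists_rat_mul_realPeriodRat_eq_plusPeriod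
  have hC' : C • V.quadraticTwist (p : ℚ) = W := by
    rw [pStar_eq_of_mod_four p (Or.inl hp4), if_pos hp4] at hC
    exact hC
  by_cases hs : V.HasSplitMultiplicativeReductionAtPrime p
  · obtain ⟨hap, -⟩ := Dm.isNewformOf.cuspCoeff_eq_one_and_sq_of_split hs
    have hap' : cuspCoeff Dm.f p = ((1 : ℤ) : ℂ) := by exact_mod_cast hap
    exact cycLowerLeadingTermAt_of_chiBranchRatCharEqMult_of_unitCoeff W p hPal hmod hp4 hX.1.2.1 V
      ⟨C, hC'⟩ hV Dm.isNewformOf (Dm.isNewformOf.dvd_level_of_split hs) hap' (Or.inl rfl) ϖ hϖ hMC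
      (hcert V C hV hC' Dm.f Dm.isNewformOf 1 hap' ϖ hϖ)
  · obtain ⟨hap, hpN⟩ := Dm.isNewformOf.cuspCoeff_eq_neg_one_and_dvd_of_nonsplit hV hs
    have hap' : cuspCoeff Dm.f p = ((-1 : ℤ) : ℂ) := by exact_mod_cast hap
    exact cycLowerLeadingTermAt_of_chiBranchRatCharEqMult_of_unitCoeff W p hPal hmod hp4 hX.1.2.1 V
      ⟨C, hC'⟩ hV Dm.isNewformOf hpN hap' (Or.inr rfl) ϖ hϖ hMC
      (hcert V C hV hC' Dm.f Dm.isNewformOf (-1) hap' ϖ hϖ)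

/-- **X4(M), `r_an = 0`, `p ≡ 1 (mod 4)`: the LOWER half `ord_p #Ш_an(E) ≤ ord_p #Ш(E)` from the rational
branch main conjecture of the multiplicative twist and the certificate** — through §0 and n1011-p18's
`ClassX4M.missingLowerBoundAt_rankZero_of_cycLeadingTermDvd` (Delbourgo 1998 Prop. 4 + §2.2 Lemma (ii),
EXACT on (M): `hDelX`; GZK; modularity). NO image, Tamagawa, Manin, anomalous or `p ≥ 5` hypothesis.
X4(M) stays CONSTRUCTION-SHAPED; nothing booked.
[cite: Delbourgo1998, Prop. 4 (p. 144), §2.2 Lemma (ii) (p. 139)] [cite: BurungaleCastellaSkinner2025, Thm. 1.1.2 (a) (shape only)] -/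
theorem _root_.Summit.BirchSwinnertonDyer.Rank1Residual.AdditivePotMult.ClassX4M.missingLowerBoundAt_rankZero_of_ratCharEqMult_of_unitCoeff
    (hDelX : Delbourgo1998.prop4_rankZero_constantCoeff_eq_unit_mul_of_potMult)
    (hPal : Pal2012.thm32_sqrt_mul_realPeriodRat_twist_eq_of_prime_one_mod_four)
    (hGZK : rank_eq_analyticRank_of_analyticRank_le_one) (hmod : hasEntireLFunction_rat)
    (hmodD : nonempty_modularParametrizationData)
    (hX : AdditivePotMult.ClassX4M W p) (hp4 : p % 4 = 1) (hr : W.analyticRank = 0)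
    (hMC : ChiBranchRatCharEqMultAt W p) (hcert : MultBranchUnitCoeffCert W p) :
    MissingLowerBoundAt W p :=
  AdditivePotMult.ClassX4M.missingLowerBoundAt_rankZero_of_cycLeadingTermDvd hDelX hGZK hmod hX hr
    (cycLeadingTermDvdAt_of_cycLowerLeadingTermAt
      (AdditivePotMult.ClassX4M.cycLowerLeadingTermAt_of_ratCharEqMult_of_unitCoeff hPal hmod hmodD hX
        hp4 hMC hcert))

/-- **X4(M) ∧ surj(p), `r_an = 0`, `p ≡ 1 (mod 4)`: `BSD(E,p)` from the rational branch main conjecture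
of the multiplicative twist and the certificate** — lower half as above, upper half IN PRINT through
additive-p1's `ClassX4M.bsdp_rankZero_of_surj_of_lower` (Delbourgo 1998 Prop. 4 `hDel`, Wuthrich L. 20
`hL20`, Kato's half-eigen divisibility `hKato`). Nothing booked. [cite: Delbourgo1998, Prop. 4 (p. 144)]
[cite: Kato2004Asterisque, Thm. 17.4 (3) (p. 273)] [cite: Miller2011LMS, Def. 1.1] -/
theorem _root_.Summit.BirchSwinnertonDyer.Rank1Residual.AdditivePotMult.ClassX4M.bsdp_rankZero_of_ratCharEqMult_of_unitCoeff_of_surj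
    (hDelX : Delbourgo1998.prop4_rankZero_constantCoeff_eq_unit_mul_of_potMult)
    (hDel : Delbourgo1998.prop4_rankZero_pow_dvd_constantCoeff)
    (hPal : Pal2012.thm32_sqrt_mul_realPeriodRat_twist_eq_of_prime_one_mod_four)
    (hGZK : rank_eq_analyticRank_of_analyticRank_le_one) (hmod : hasEntireLFunction_rat)
    (hmodD : nonempty_modularParametrizationData)
    (hL20 : Wuthrich2014.lemma20_surjective_threeAdic_of_semistable)
    (hKato : Wuthrich2014.kato_halfEigenCharIdeal_dvd_cyclotomicPrime_of_surjective)
    (hX : AdditivePotMult.ClassX4M W p) (hp4 : p % 4 = 1) (hr : W.analyticRank = 0) (hsurj : Surj W p)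
    (hMC : ChiBranchRatCharEqMultAt W p) (hcert : MultBranchUnitCoeffCert W p) : BSDp W p :=
  AdditivePotMult.ClassX4M.bsdp_rankZero_of_surj_of_lower hDel hGZK hmod hmodD hL20 hKato hX hr hsurj
    (AdditivePotMult.ClassX4M.missingLowerBoundAt_rankZero_of_ratCharEqMult_of_unitCoeff hDelX hPal
      hGZK hmod hmodD hX hp4 hr hMC hcert)

end Summit.BirchSwinnertonDyer.Rank1Residual.Additive

end
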